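import Summits.Ventures.PercRepro.C026ThreeSum

/-!
# Bit-planes for the 6-vertex gadget, III: the state of a configuration (p5, gen 13)

`stateOf ω` packs the open and closed class bits of a configuration of a graph supported on six vertices;
its rows are the configuration's rows, so the events `bot`, `BAD`, `o1`, `o2` are bits of the planes.
-/

namespace PercRepro

namespace MultiGraph
open PairModel Plane6

variable {V E : Type*} {G : MultiGraph V E} {ι : ℕ → V}

/-! ### V. The state of a configuration of a supported graph on six vertices -/

/-- The first vertex of class `t`. -/
def clsU (t : ℕ) : ℕ :=
  match t with
  | 0 => 0 | 1 => 0 | 2 => 0 | 3 => 1 | 4 => 1 | 5 => 1 | 6 => 2 | 7 => 2 | 8 => 2 | 9 => 3 | 10 => 3 | 11 => 4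
  | _ => 0

/-- The second vertex of class `t`. -/
def clsV (t : ℕ) : ℕ :=
  match t with
  | 0 => 3 | 1 => 4 | 2 => 5 | 3 => 3 | 4 => 4 | 5 => 5 | 6 => 3 | 7 => 4 | 8 => 5 | 9 => 4 | 10 => 5 | 11 => 5
  | _ => 0

/-- The class table is consistent with `cls`: a pair with a class is that class's pair (in one of the two
orders); a pair without a class is a loop or a mark–mark pair. -/
def clsOK (i j : ℕ) : Bool :=
  match Plane6.cls i j with
  | some t => decide (t < 12) && ((clsU t == i && clsV t == j) || (clsU t == j && clsV t == i))
  | none => (i == j) || (decide (i < 3) && decide (j < 3))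

/-- The class table is consistent with `cls` on every pair below `6` (by `decide`). -/
theorem clsOK_all : ∀ i : ℕ, i < 6 → ∀ j : ℕ, j < 6 → clsOK i j = true := by decide

/-- The twelve class bits of rows. -/
def enc6 (R : Rows) : ℕ := maskOf 12 fun t => adj R (clsU t) (clsV t)

/-- The class bits are below `2^12`. -/
theorem enc6_lt (R : Rows) : enc6 R < 2 ^ 12 := maskOf_lt 12 _

/-- The state of a configuration: the open class bits and, `2^12` higher, the closed class bits. -/
noncomputable def stateOf (ω : Config E) : ℕ := 2 ^ 12 * enc6 (G.cRows ι 6 ω) + enc6 (G.oRows ι 6 ω)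

/-- The state of a configuration is below `NS`. -/
theorem stateOf_lt (ω : Config E) : (G.stateOf (ι := ι) ω) < NS := by
  unfold stateOf NS
  have h1 := enc6_lt (G.cRows ι 6 ω)
  have h2 := enc6_lt (G.oRows ι 6 ω)
  calc 2 ^ 12 * enc6 (G.cRows ι 6 ω) + enc6 (G.oRows ι 6 ω)
      < 2 ^ 12 * enc6 (G.cRows ι 6 ω) + 2 ^ 12 := by omega
    _ = 2 ^ 12 * (enc6 (G.cRows ι 6 ω) + 1) := by ring
    _ ≤ 2 ^ 12 * 2 ^ 12 := Nat.mul_le_mul_left _ (by omega)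
    _ = 2 ^ 24 := by norm_num

/-- Bit `t < 12` of the state: the open entry of class `t`. -/
theorem testBit_stateOf_lo (ω : Config E) {t : ℕ} (ht : t < 12) :
    (G.stateOf (ι := ι) ω).testBit t = adj (G.oRows ι 6 ω) (clsU t) (clsV t) := by
  unfold stateOf
  rw [Nat.testBit_two_pow_mul_add _ (enc6_lt _)]
  simp [ht, enc6, testBit_maskOf]

/-- Bit `12 + t` of the state: the closed entry of class `t`. -/
theorem testBit_stateOf_hi (ω : Config E) {t : ℕ} (ht : t < 12) :
    (G.stateOf (ι := ι) ω).testBit (12 + t) = adj (G.cRows ι 6 ω) (clsU t) (clsV t) := by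
  unfold stateOf
  rw [Nat.testBit_two_pow_mul_add _ (enc6_lt _)]
  have h1 : ¬ (12 + t < 12) := by omega
  simp [h1, enc6, testBit_maskOf, ht]

variable (hinj : InjBelow ι 6)
variable (hnm : ∀ e, ∃ k, 3 ≤ k ∧ k < 6 ∧ (G.fst e = ι k ∨ G.snd e = ι k))
include hinj hnm

/-- The open rows of `ω` are the open rows of its state. -/
theorem oRowsAt_stateOf (ω : Config E) : oRowsAt (G.stateOf (ι := ι) ω) = G.oRows ι 6 ω := by
  rw [oRows_eq_map ω]
  unfold oRowsAt
  apply List.map_congr_left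
  intro i hi
  have hi' : i < 6 := by simpa using hi
  apply maskOf_congr
  intro j hj
  have hok := clsOK_all i hi' j hj
  unfold clsOK at hok
  unfold oBit
  cases hc : Plane6.cls i j with
  | none =>
    rw [hc] at hok
    simp only [Bool.or_eq_true, beq_iff_eq, Bool.and_eq_true, decide_eq_true_eq] at hok
    rcases hok with rfl | ⟨hi3, hj3⟩
    · exact (adj_oRows_self ω i).symm
    · exact ((adj_eq_false_of_marks hinj (by norm_num) hnm ω hi3 hj3).1).symm
  | some t =>
    rw [hc] at hok
    simp only [Bool.and_eq_true, decide_eq_true_eq, Bool.or_eq_true, beq_iff_eq] at hok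
    obtain ⟨ht, h⟩ := hok
    dsimp only
    rw [testBit_stateOf_lo ω ht]
    rcases h with ⟨h1, h2⟩ | ⟨h1, h2⟩
    · rw [h1, h2]
    · rw [h1, h2]; exact adj_oRows_symm ω hj hi'

/-- The closed rows of `ω` are the closed rows of its state. -/
theorem cRowsAt_stateOf (ω : Config E) : cRowsAt (G.stateOf (ι := ι) ω) = G.cRows ι 6 ω := by
  rw [cRows_eq_map ω]
  unfold cRowsAt
  apply List.map_congr_left
  intro i hi
  have hi' : i < 6 := by simpa using hi
  apply maskOf_congr
  intro j hj
  have hok := clsOK_all i hi' j hj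
  unfold clsOK at hok
  unfold cBit
  cases hc : Plane6.cls i j with
  | none =>
    rw [hc] at hok
    simp only [Bool.or_eq_true, beq_iff_eq, Bool.and_eq_true, decide_eq_true_eq] at hok
    rcases hok with rfl | ⟨hi3, hj3⟩
    · exact (adj_cRows_self ω i).symm
    · exact ((adj_eq_false_of_marks hinj (by norm_num) hnm ω hi3 hj3).2).symm
  | some t =>
    rw [hc] at hok
    simp only [Bool.and_eq_true, decide_eq_true_eq, Bool.or_eq_true, beq_iff_eq] at hok
    obtain ⟨ht, h⟩ := hok
    dsimp only
    rw [testBit_stateOf_hi ω ht]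
    rcases h with ⟨h1, h2⟩ | ⟨h1, h2⟩
    · rw [h1, h2]
    · rw [h1, h2]; exact adj_cRows_symm ω hj hi'

variable (hsup : G.Supported ι 6)
include hsup

/-- `bot` of a configuration is the `bot` bit of its state. -/
theorem isBot_iff_bit (ω : Config E) :
    G.IsBot ω (ι 0) (ι 1) (ι 2) ↔ bot.testBit (G.stateOf (ι := ι) ω) = true := by
  rw [isBot_iff_botB hsup hinj (by norm_num), testBit_bot (stateOf_lt ω), oRowsAt_stateOf hinj hnm]

/-- `BAD` of a configuration is the `BAD` bit of its state. -/
theorem hConn_iff_bit (ω : Config E) :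
    G.HConn ω (ι 2) (ι 0) (ι 1) ↔ BAD.testBit (G.stateOf (ι := ι) ω) = true := by
  rw [hConn_ab_iff_badB hsup hinj (by norm_num), testBit_BAD (stateOf_lt ω), oRowsAt_stateOf hinj hnm,
    cRowsAt_stateOf hinj hnm]

/-- `o1` of a configuration is the `o1` bit of its state. -/
theorem o1_iff_bit (ω : Config E) :
    G.HConnAvoid ω (ι 2) (G.cluster ω (ι 1)) (ι 2) (ι 0) ↔ o1.testBit (G.stateOf (ι := ι) ω) = true := by
  rw [hConnAvoid_ca_iff_o1B hsup hinj (by norm_num), testBit_o1 (stateOf_lt ω), oRowsAt_stateOf hinj hnm,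
    cRowsAt_stateOf hinj hnm]

/-- `o2` of a configuration is the `o2` bit of its state. -/
theorem o2_iff_bit (ω : Config E) :
    G.HConnAvoid ω (ι 2) (G.cluster ω (ι 0)) (ι 2) (ι 1) ↔ o2.testBit (G.stateOf (ι := ι) ω) = true := by
  rw [hConnAvoid_cb_iff_o2B hsup hinj (by norm_num), testBit_o2 (stateOf_lt ω), oRowsAt_stateOf hinj hnm,
    cRowsAt_stateOf hinj hnm]


end MultiGraph

end PercRepro
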